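/-
Copyright (c) 2026 the pub-hodgecm-mathlib formalisation cell (harness21).  Prover seat hodgecm-mathlib-LH7-p09 (g3), CLOSE-OUT ROSTER strike line L3∕L5 (Track A
«(D-RAM) FOUR-FRAME» squad F0∕P3c∕LH4 ∕ F0∕P3c∕LH7); MIX-HI family (β₂ WORDs #34∕#36, lead LH4-p13 (g10) «LH7-p09: U-MIX worker»): the three-way literal reads (hL₁)(hL₂)
of the count socket ★ p864098 for an upper-line LOW cell (RAY or MIX), read through LH4-p13's ★ p864672 ∕ ★ p864917 instead of ★ R1a, 2026-09-05.
-/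
import Summits.HodgeConjecture.HodgeConjecture.Theorems.F0P3cDyRamMixBandProductRead                 -- ★ p864672 (LH4-p13 (g10)): `reads_of_weight_ne_zero` (the two literals ↔ `NX ∧ Pc` ∕ `NX ∧ ¬Pc`)
import Summits.HodgeConjecture.HodgeConjecture.Theorems.F0P3cDyRamMixBandDigitReads                  -- ★ p864917 (LH4-p13 (g10)): `digitReads_of_presentation` (`NX`, `Pc` read on the digit at a frame)
import Summits.HodgeConjecture.HodgeConjecture.Theorems.F0P3cDyRamUpperRayCellReads                  -- ★ p864444 (LH4-p19 (g3), R1b-A): `exists_vertexFrame_of_gen`; brings ★ p863914, ★ `trace_letters`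
import Summits.HodgeConjecture.HodgeConjecture.Theorems.F0P3cDyRamConeCellFaceTube                    -- ★ (LH4 lineage): `exists_fixed_unit_weight_eq_natCard_normFibre` (a presentation WITH a fixed unit glue)
import Summits.HodgeConjecture.HodgeConjecture.Theorems.F0P3cDyRamRowCellGeneratorIndependenceSharp   -- ★ p864599 (this seat): `v_coord_sub_coord_mul_le_sharp_of_gen` (sharp (hI), normalisation-free)
import Summits.HodgeConjecture.HodgeConjecture.Theorems.F0P3cDyRamRootRegimeAffineLabel               -- ★ (LH4-p19 (g3)): `v_mul_eq_of_v_sub_lt`, `v_centre_iff_of_lt` (root-regime dictionary)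
import Summits.HodgeConjecture.HodgeConjecture.Theorems.F0P3cDyRamPieceRowsWildUnit0OfExports          -- ★ p857318: `v_two_lt_one_of_not_isUnit_two`
import Literature.NumberTheory.LocalFields.WildQuadraticDatumNormSignConductor                       -- ★ Lit: `normSign_eq_of_near`, `normSign_mul_of_fixed`
import HarnessLib

/-!
# Crux `H413`, line LH4 «(D-RAM) FOUR-FRAME» — STAGE-1b, row (2), the (β₂) road (R-36), (OFF) residue, UPPER line, LOW band (RAY ∪ MIX): «THE LITERAL READS OF AN UPPER-LINE
# CELL WITHOUT RAY DOMINATION» — for a populated member `(Λ, x₀)` the two literal predicates «∃ glued `L₃` at exact level `ℓ₀` with `VS_{m⋆} = V(X₊)`» ∕ «… `= V(c₀ • X₊)`»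
# are the sphere digit `|γ₁(V − W₁)| = 1` together with the sign `ω(γ₁(V − W₁)) = ω(−h_W)` ∕ `≠`, `V = V(x₀)` — the hypotheses (hL₁)(hL₂) of ★ p864098, read through the
# MIX-HI lead's presentation-free predicates `NX`, `Pc` (★ p864672, ★ p864917) instead of ★ R1a's ray-dominated label

Cell `hodgecm-mathlib` (D-0151), FLOOR 0, crux item H413 = `stmt-HodgeConjecture-24833`, route of record `HCCMUnconditional`; squad F0∕P3c∕LH4 ∕ LH7; lane
`--supports stmt-HodgeConjecture-24833 --as helper` (count-neutral; pays NO tier-0 row).  THEOREMS ONLY (no `def`, no instance, no notation, no `sorry`, default heartbeats);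
★-only imports; states NO law; (β₂) stays a HYPOTHESIS.  Frame = ★ p864672's (block `(H₂, h_W)`, the line model, `jE`-letters, E-datum with `E` complete, `¬ IsUnit 2`, the
literal `(γ₂, u)` with `lam`'s characteristic polynomial and the unitary embedding `P₁`, the fence `m_c ≤ nF` with `|u₀₀ − 1| ≤ |ϖ^{nF}|`, `|lam − 1| ≤ |ϖE^{nF}|`, the cell
`(j, b)` with `1 ≤ b`, `d ≤ b`, `b ≤ j`, `lam ∈ 𝒪_j`, the FOUR CELL LETTERS `hμl hlamρ hμk hprod`, the weight letter `hf`, the predicates `NX`, `Pc` with their defining `Iff`s, a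
`σ`-fixed non-norm unit `c₀`) + ★ p864917's flip unit `(z, ξf)` + the M-side datum `hDM` + the CELL-LEVEL letters of the digit worker: `hFgap`; reference pair `κ₀, ξ₀`
(`|κ₀| ≤ |ξ₀|`, `|ϖE|^b ≤ |ξ₀|·|cc(α − ρα)|`); centre `W`, slope `BE`, `P = (ϖσϖ)^b`, fixed `γ₁, W₁` with the SLOPE∕ROOT letters; the SHARP digit transfer letter
`hγr : |γ₁|·|ϖ|^{2b+d−1} ≤ |ϖ|^{2d−1}·|ξ₀|·|cc(α − ρα)|` (reads `s ≥ d + ℓ₀` at `|γ₁| = |ϖ|^{s−ℓ₀−b}`, `|ξ₀|·|cc(α − ρα)| = |ϖE|^b`); `ρμ ≠ μ`.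

WHY (MIX-HI lead LH4-p13 (g10) 03:16:19Z «LH7-p09: U-MIX worker»: the W3-clone for `hU_mix` ∕ `hD_mix` of ★ p863760 ∕ ★ p863936 goes through ★ R0's socket; its (hL₁)(hL₂) must
read the literals at the socket's generator `x₀` WITHOUT the RAY band's ray domination `m⋆ ≤ s`, on which ★ R1b-B relies).  ★ p864672 reads both literals of a POPULATED member as
`NX Λ ∧ Pc Λ` ∕ `NX Λ ∧ ¬Pc Λ` (exact-level digit, product class — presentation-free); ★ `exists_fixed_unit_weight_eq_natCard_normFibre` gives a presentation `x₁` WITH a `σ`-fixed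
unit glue `r₁`; at the frame `(w₁, V₁)` of `x₁` (★ R1b-A) the digit value is `a₁ = BE·(V₁ − W)` (`jE a₁ = ρμ + (μ − ρμ)·κ̂(u₁)`, as `(μ − ρμ)·κ_c = −ρμ`), and ★ p864917 reads
`NX Λ ↔ |⟨w₁,w₁⟩|·|a₁| = |ϖ|^{ℓ₀} ↔ |θ(V₁ − W)| = 1 ↔ |γ₁(V₁ − W₁)| = 1` (`|⟨w₁,w₁⟩P| = 1`, `|t₊| = |ϖ|^{ℓ₀}`, root regime) and — ON that sphere, with the `σ`-fixed unit
`e′ = ⟨w₁,w₁⟩·P·γ₁(V₁ − W₁)`, `|⟨w₁,w₁⟩a₁ − e′t₊| = |t₊|·|(θ − γ₁)(V₁ − W) + γ₁(W₁ − W)| ≤ |ϖ|^{m⋆}` — `Pc Λ ↔ γ₁(V₁ − W₁)·(−P∕h_W) ∈ N ↔ ω(γ₁(V₁ − W₁)) = ω(−h_W)` (`ω`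
multiplicative on fixed elements, `−P∕h_W = (−h_W)·N(ϖ^b∕h_W)`).  ★ p864599 moves `V₁` to `V = V(x₀)`: `|γ₁(V₁ − V)| ≤ |ϖ|^{2d−1}` (`hγr`), under which sphere and sign are constant.
* HEAD `reads_of_gen6_upperMix` — both iff's at once, for the six-clause `GEN` of ★ p864098 and `f b j Λ ≠ 0`; literal bodies = ★ p864672's two literals VERBATIM.
HONEST LABEL.  Count-neutral bookkeeping; nothing printed is asserted; no census law is stated; `hU_mix`, `hD_mix`, ‹PRODBAL-U∕D› stay OPEN; `HC_CM` is proved only modulo the 7 printed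
citations (2 remaining named inputs: hLiu418 = `stmt-HodgeConjecture-24832`, h413 = `stmt-HodgeConjecture-24833`) until rung 0 closes.
## References
* [Kottwitz1986BaseChangeUnits] R. E. Kottwitz, *Base change for unit elements of Hecke algebras*, Compositio Math. 60 (1986): §1 pp. 240–241, §3.
* [Jacobowitz1962] R. Jacobowitz, *Hermitian forms over local fields*, Amer. J. Math. 84 (1962): §4.
* [Rogawski1990] J. D. Rogawski, *Automorphic Representations of Unitary Groups in Three Variables*, Ann. of Math. Stud. 123 (1990): §4.9 Prop. 4.9.1 (b) p. 55, §12.2.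
* [Serre1979] J.-P. Serre, *Local Fields*, GTM 67 (1979): Ch. III §3 Prop. 7, §6 Prop. 12; Ch. V §3 Cor. 3; Ch. XV §2.
-/

set_option autoImplicit false

noncomputable section

namespace Summit.HodgeConjecture.HodgeConjecture.Cruxes.H413.F0P3cDyRamUpperMixCellLiteralReads

open scoped Valued WithZero Matrix MatrixGroups
open WithZero
open Literature.NumberTheory.Automorphic Literature.NumberTheory.Automorphic.HermitianLattice Literature.NumberTheory.Automorphic.UnitaryLatticeTree
open Literature.NumberTheory.Automorphic.UnitaryThreeFourFrame (IsRamifiedQuadraticDatum normSign normSign_of_isNorm)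
open Literature.NumberTheory.Rogawski1990
open Literature.NumberTheory.LocalFields.WildQuadraticDatum (normSign_eq_of_near normSign_mul_of_fixed)
open Summit.HodgeConjecture.HodgeConjecture.Cruxes.H413.F0P3cDyRamFourFramePieces
open Summit.HodgeConjecture.HodgeConjecture.Cruxes.H413.F0P3cDyRamFourFrameCensusDefs (LatticeInLevel)
open Summit.HodgeConjecture.HodgeConjecture.Cruxes.H413.F0P3cDyRamStageOneBDefs (mcOfRecord)
open Summit.HodgeConjecture.HodgeConjecture.Cruxes.H413.F0P3cDyRamToricCensusDefs
open Summit.HodgeConjecture.HodgeConjecture.Cruxes.H413.F0P3cDyRamLabelShellFlipCardTwo (v_refSkew_eq)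
open Summit.HodgeConjecture.HodgeConjecture.Cruxes.H413.F0P3cDyRamPieceRowsWildUnit0OfExports (v_two_lt_one_of_not_isUnit_two)
open Summit.HodgeConjecture.HodgeConjecture.Cruxes.H413.F0P3cDyRamRootRegimeAffineLabel (v_mul_eq_of_v_sub_lt v_centre_iff_of_lt)
open Summit.HodgeConjecture.HodgeConjecture.Cruxes.H413.F0P3cDyRamRowCellFibreTransport (trace_letters)
open Summit.HodgeConjecture.HodgeConjecture.Cruxes.H413.F0P3cDyRamConeCellFaceTube (exists_fixed_unit_weight_eq_natCard_normFibre)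
open Summit.HodgeConjecture.HodgeConjecture.Cruxes.H413.F0P3cDyRamRowCellGeneratorIndependenceSharp (v_coord_sub_coord_mul_le_sharp_of_gen)
open Summit.HodgeConjecture.HodgeConjecture.Cruxes.H413.F0P3cDyRamRowVertexPopulationRead (normSign_mul_eq_one_iff_eq)
open Summit.HodgeConjecture.HodgeConjecture.Cruxes.H413.F0P3cDyRamUpperRayCellReads (exists_vertexFrame_of_gen)
open Summit.HodgeConjecture.HodgeConjecture.Cruxes.H413.F0P3cDyRamMixBandProductRead (reads_of_weight_ne_zero)
open Summit.HodgeConjecture.HodgeConjecture.Cruxes.H413.F0P3cDyRamMixBandDigitReads (digitReads_of_presentation)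

variable {E M : Type} [Field E] [Valued E ℤᵐ⁰] [Field M] [Valued M ℤᵐ⁰] {ρ Θ : M →+* M} {α : M}

/-- **HEAD — «THE LITERAL READS OF A POPULATED MEMBER OF AN UPPER-LINE LOW CELL, WITHOUT RAY DOMINATION».**  See the module docstring for the frame.  THEN for every member
`(Λ, x₀)` with the six `GEN` clauses and `f b j Λ ≠ 0`:
`(∃ B, φ(B) = Λ ∧ ∃ L₃, SD ∧ L₃ ∩ W = ι_W B ∧ tube_b ∧ ((InLevel ℓ₀ ∧ ¬ InLevel (ℓ₀+1)) ∧ VS_{m⋆}(L₃) = V(X₊))) ↔ ∃ Ve, jE Ve = Vf x₀ ∧ |γ₁(Ve − W₁)| = 1 ∧ ψ Ve`, and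
`(∃ B, … ∧ ((InLevel ℓ₀ ∧ ¬ InLevel (ℓ₀+1)) ∧ VS_{m⋆}(L₃) = V(c₀ • X₊))) ↔ ∃ Ve, jE Ve = Vf x₀ ∧ |γ₁(Ve − W₁)| = 1 ∧ ¬ ψ Ve`, where `Vf x₀ = (ρu₀∕t − κ₀)∕ξ₀`,
`ψ Ve :≡ |γ₁(Ve − W₁)| = 1 → ω(γ₁(Ve − W₁)) = ω(−h_W)` — the literal bodies are ★ p864672's VERBATIM.
[cite: Kottwitz1986BaseChangeUnits, §1 pp. 240–241] [cite: Jacobowitz1962, §4] [cite: Rogawski1990, §4.9 Prop. 4.9.1 (b) p. 55] [cite: Serre1979, Ch. III §3 Prop. 7; Ch. V §3 Cor. 3; Ch. XV §2] -/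
theorem reads_of_gen6_upperMix [CompleteSpace E] [IsDiscreteValuationRing 𝒪[E]] [Finite 𝓀[E]]
    {σ : E →+* E} {ϖ : E} {d tE : ℕ} (hD : IsRamifiedQuadraticDatum σ ϖ d tE) (h2 : ¬ IsUnit (2 : 𝒪[E]))
    (jE : E →+* M) (hjiso : ∀ a, Valued.v (jE a) = Valued.v a) (hjfix : ∀ z, ρ z = z ↔ ∃ c, jE c = z) (hΘj : ∀ c, Θ (jE c) = jE (σ c))
    (hjpow : ∀ (t : E) (n : ℤ), Valued.v (jE t) = Valued.v (jE ϖ) ^ n ↔ Valued.v t = Valued.v ϖ ^ n)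
    (hϖmax : ∀ t : M, ρ t = t → Valued.v t < 1 → Valued.v t ≤ Valued.v (jE ϖ))
    (hρρ : ∀ x, ρ (ρ x) = x) (hvρ : ∀ x, Valued.v (ρ x) = Valued.v x) (hα : ρ α ≠ α) (hα1 : Valued.v α ≤ 1)
    (hint : ∀ z : M, Valued.v z ≤ 1 → Valued.v ((z - ρ z) / (α - ρ α)) ≤ 1)
    (hΘΘ : ∀ x, Θ (Θ x) = x) (hΘρ : ∀ x, Θ (ρ x) = ρ (Θ x)) (hvΘ : ∀ x, Valued.v (Θ x) = Valued.v x)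
    {tM : ℕ} (hDM : IsRamifiedQuadraticDatum Θ (jE ϖ) d tM)
    {h : M} (hΘh : Θ h = h) (hh : h ≠ 0)
    {H₂ : Matrix (Fin 2) (Fin 2) E} (hH₂ : IsUnit H₂.det) (hH₂σ : (H₂.map σ)ᵀ = H₂) {hW : E} (hhW : Valued.v hW = 1) (hhWσ : σ hW = hW)
    (φ : (Fin 2 → E) →+ M) (hφs : ∀ (c : E) (x : Fin 2 → E), φ (c • x) = jE c * φ x) (hφi : Function.Injective φ) (hφo : Function.Surjective φ)
    {γ₂ : GL (Fin 2) E} {lam : M} (hφγ : ∀ x, φ ((γ₂ : Matrix (Fin 2) (Fin 2) E).mulVec x) = lam * φ x) (hvlam : Valued.v lam = 1)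
    (hform : ∀ x y, jE (pairing σ H₂ x y) = h * Θ (φ x) * φ y + ρ (h * Θ (φ x) * φ y))
    -- the literal `(γ₂, u)`: `lam`'s characteristic polynomial and the unitary embedding (for ★ p864672 ∕ ★ p864917)
    (hlam2 : lam * lam = jE (γ₂ : Matrix (Fin 2) (Fin 2) E).trace * lam - jE (γ₂ : Matrix (Fin 2) (Fin 2) E).det)
    (hρlam : ρ lam = jE (γ₂ : Matrix (Fin 2) (Fin 2) E).trace - lam) (u : GL (Fin 1) E)
    (P₁ : GL (Fin 3) E) (hA : formCongr σ P₁ ((StdForm.antidiagonal 3).over E) = (!![H₂ 0 0, 0, H₂ 0 1; 0, hW, 0; H₂ 1 0, 0, H₂ 1 1] : Matrix (Fin 3) (Fin 3) E))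
    (hΓ : P₁ * endoGL (γ₂, u) * P₁⁻¹ ∈ unitaryGroupOfForm σ ((StdForm.antidiagonal 3).over E))
    -- the fence
    {nF : ℕ} (hnF : mcOfRecord d ≤ nF) (hu1N : Valued.v (((u : Matrix (Fin 1) (Fin 1) E) 0 0) - 1) ≤ Valued.v (ϖ ^ nF)) (hlam1 : Valued.v (lam - 1) ≤ Valued.v (jE ϖ ^ nF))
    -- the cell and its four letters (★ p864672's)
    {j b : ℕ} (hb1 : 1 ≤ b) (hdb : d ≤ b) (hbj : b ≤ j) (hcc : jE ϖ ^ j * (α - ρ α) ≠ 0) (hlamj : IsOrd ρ α (jE ϖ ^ j) lam)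
    (hμl : Valued.v (lam - jE ((u : Matrix (Fin 1) (Fin 1) E) 0 0)) ≤ Valued.v (jE ϖ) ^ (d % 2 + 1 + b))
    (hlamρ : Valued.v (lam - ρ lam) ≤ Valued.v (jE ϖ ^ j * (α - ρ α)) * Valued.v (jE ϖ) ^ (d % 2 + 1))
    (hμk : Valued.v (lam - jE ((u : Matrix (Fin 1) (Fin 1) E) 0 0)) ≤ Valued.v (jE ϖ) ^ (mcOfRecord d - d % 2))
    (hprod : Valued.v (lam - jE ((u : Matrix (Fin 1) (Fin 1) E) 0 0)) * Valued.v ((lam - jE ((u : Matrix (Fin 1) (Fin 1) E) 0 0)) - ρ (lam - jE ((u : Matrix (Fin 1) (Fin 1) E) 0 0))) ≤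
      Valued.v (jE ϖ ^ j * (α - ρ α)) * Valued.v (jE ϖ) ^ b * Valued.v (jE ϖ) ^ mcOfRecord d)
    (f : ℕ → ℕ → AddSubgroup M → ℕ)
    (hf : ∀ (b j : ℕ) (Λ : AddSubgroup M) (x₀ : M) (r : E), 1 ≤ b → x₀ ≠ 0 →
      (∀ x, x ∈ Λ ↔ ∃ z, IsOrd ρ α (jE ϖ ^ j) z ∧ x = x₀ * z) →
      IsOrd ρ α (jE ϖ ^ j) (dualGen ρ Θ α (jE ϖ ^ j) h x₀) → ¬ IsOrd ρ α (jE ϖ ^ j) (dualGen ρ Θ α (jE ϖ ^ j) h x₀ / jE ϖ) →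
      Valued.v (dualGen ρ Θ α (jE ϖ ^ j) h x₀) = Valued.v (jE ϖ) ^ b →
      (∀ b', (∀ x ∈ Λ, Valued.v (h * Θ x * b' + ρ (h * Θ x * b')) ≤ 1) → (lam - jE ((u : Matrix (Fin 1) (Fin 1) E) 0 0)) * b' ∈ Λ) →
      IsOrd ρ α (jE ϖ ^ j) lam → jE r = glueUnit ρ Θ α (jE ϖ ^ j) h (jE ϖ) (jE hW) x₀ b →
      f b j Λ = Nat.card {x : 𝒪[E] ⧸ 𝓂[E] ^ (2 * b) // ∃ u' : 𝒪[E], Ideal.Quotient.mk (𝓂[E] ^ (2 * b)) u' = x ∧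
        Valued.v ((u' : E) * σ u' - r) ≤ Valued.v (ϖ ^ (2 * b))})
    -- the exact-level digit and the product class (★ p864672's predicates with their defining `Iff`s)
    (NX : AddSubgroup M → Prop)
    (hNX : ∀ Λ, NX Λ ↔ ∃ (x₀ : M) (e₀ : E), x₀ ≠ 0 ∧ (∀ x, x ∈ Λ ↔ ∃ ζ, IsOrd ρ α (jE ϖ ^ j) ζ ∧ x = x₀ * ζ) ∧
      IsOrd ρ α (jE ϖ ^ j) (dualGen ρ Θ α (jE ϖ ^ j) h x₀) ∧ ¬ IsOrd ρ α (jE ϖ ^ j) (dualGen ρ Θ α (jE ϖ ^ j) h x₀ / jE ϖ) ∧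
      Valued.v (dualGen ρ Θ α (jE ϖ ^ j) h x₀) = Valued.v (jE ϖ) ^ b ∧
      jE e₀ = (lam - jE ((u : Matrix (Fin 1) (Fin 1) E) 0 0)) / (jE ϖ ^ j * (α - ρ α) * Θ (dualGen ρ Θ α (jE ϖ ^ j) h x₀)) +
        ρ ((lam - jE ((u : Matrix (Fin 1) (Fin 1) E) 0 0)) / (jE ϖ ^ j * (α - ρ α) * Θ (dualGen ρ Θ α (jE ϖ ^ j) h x₀))) ∧
      Valued.v e₀ = Valued.v ϖ ^ (d % 2))
    (Pc : AddSubgroup M → Prop)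
    (hPc : ∀ Λ, Pc Λ ↔ ∃ (x₀ : M) (r e₀ e' : E), x₀ ≠ 0 ∧ (∀ x, x ∈ Λ ↔ ∃ ζ, IsOrd ρ α (jE ϖ ^ j) ζ ∧ x = x₀ * ζ) ∧
      IsOrd ρ α (jE ϖ ^ j) (dualGen ρ Θ α (jE ϖ ^ j) h x₀) ∧ ¬ IsOrd ρ α (jE ϖ ^ j) (dualGen ρ Θ α (jE ϖ ^ j) h x₀ / jE ϖ) ∧
      Valued.v (dualGen ρ Θ α (jE ϖ ^ j) h x₀) = Valued.v (jE ϖ) ^ b ∧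
      σ r = r ∧ Valued.v r = 1 ∧ jE r = glueUnit ρ Θ α (jE ϖ ^ j) h (jE ϖ) (jE hW) x₀ b ∧
      jE e₀ = (lam - jE ((u : Matrix (Fin 1) (Fin 1) E) 0 0)) / (jE ϖ ^ j * (α - ρ α) * Θ (dualGen ρ Θ α (jE ϖ ^ j) h x₀)) +
        ρ ((lam - jE ((u : Matrix (Fin 1) (Fin 1) E) 0 0)) / (jE ϖ ^ j * (α - ρ α) * Θ (dualGen ρ Θ α (jE ϖ ^ j) h x₀))) ∧
      σ e' = e' ∧ Valued.v e' = 1 ∧ Valued.v (e₀ - e' * ((ϖ - σ ϖ) * ((ϖ * σ ϖ) ^ ((d - d % 2) / 2))⁻¹)) ≤ Valued.v ϖ ^ mstarOfRecord d ∧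
      ∃ c : E, c * σ c = r * e')
    -- the flip unit of ★ p864917 and the `σ`-fixed non-norm unit of the second literal
    (z : M) (hz1 : Valued.v z = 1) (ξf : E) (hzξ : z * Θ z = jE ξf) (hσξf : σ ξf = ξf) (hξN : ¬ ∃ e : E, e * σ e = ξf)
    {c₀ : E} (hσc₀ : σ c₀ = c₀) (hc₀1 : Valued.v c₀ = 1) (hc₀N : ¬ ∃ e : E, e * σ e = c₀)
    -- cell-level letters of the digit worker
    (hFgap : ∀ w : M, ρ w = w → Θ w = w → Valued.v (jE ϖ) < Valued.v w → Valued.v w ≤ 1 → Valued.v w = 1)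
    {κ₀ ξ₀ : M} (hκ₀ : κ₀ + ρ κ₀ = 1) (hΘκ₀ : Θ κ₀ = κ₀) (hξ : ρ ξ₀ = -ξ₀) (hΘξ : Θ ξ₀ = ξ₀) (hξ0 : ξ₀ ≠ 0)
    (hκ₀v : Valued.v κ₀ ≤ Valued.v ξ₀) (hR : Valued.v (jE ϖ) ^ b ≤ Valued.v ξ₀ * Valued.v (jE ϖ ^ j * (α - ρ α)))
    {W BE P γ₁ W₁ : E}
    (hWc : jE W * ξ₀ = ρ (lam - jE ((u : Matrix (Fin 1) (Fin 1) E) 0 0)) / (ρ (lam - jE ((u : Matrix (Fin 1) (Fin 1) E) 0 0)) - (lam - jE ((u : Matrix (Fin 1) (Fin 1) E) 0 0))) - κ₀)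
    (hBE : jE BE = ((lam - jE ((u : Matrix (Fin 1) (Fin 1) E) 0 0)) - ρ (lam - jE ((u : Matrix (Fin 1) (Fin 1) E) 0 0))) * ξ₀)
    (hP0 : P ≠ 0) (hσP : σ P = P) (hPb : P = (ϖ * σ ϖ) ^ b) (hσγ : σ γ₁ = γ₁) (hσW₁ : σ W₁ = W₁)
    (hθ : Valued.v (BE / (P * ((ϖ - σ ϖ) * ((ϖ * σ ϖ) ^ ((d - d % 2) / 2))⁻¹)) - γ₁) ≤ Valued.v γ₁ * Valued.v ϖ ^ (2 * d - 1))
    (hWW : Valued.v (γ₁ * (W - W₁)) ≤ Valued.v ϖ ^ (2 * d - 1))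
    (hγr : Valued.v γ₁ * Valued.v ϖ ^ (2 * b + d - 1) ≤ Valued.v ϖ ^ (2 * d - 1) * (Valued.v ξ₀ * Valued.v (jE ϖ ^ j * (α - ρ α))))
    (hμρ : ρ (lam - jE ((u : Matrix (Fin 1) (Fin 1) E) 0 0)) ≠ lam - jE ((u : Matrix (Fin 1) (Fin 1) E) 0 0))
    (Λ : AddSubgroup M) (x₀ : M)
    (hG : x₀ ≠ 0 ∧ (∀ x, x ∈ Λ ↔ ∃ ζ, IsOrd ρ α (jE ϖ ^ j) ζ ∧ x = x₀ * ζ) ∧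
      IsOrd ρ α (jE ϖ ^ j) (dualGen ρ Θ α (jE ϖ ^ j) h x₀) ∧ ¬ IsOrd ρ α (jE ϖ ^ j) (dualGen ρ Θ α (jE ϖ ^ j) h x₀ / jE ϖ) ∧
      Valued.v (dualGen ρ Θ α (jE ϖ ^ j) h x₀) = Valued.v (jE ϖ) ^ b ∧
      (∀ b', (∀ x ∈ Λ, Valued.v (h * Θ x * b' + ρ (h * Θ x * b')) ≤ 1) → (lam - jE ((u : Matrix (Fin 1) (Fin 1) E) 0 0)) * b' ∈ Λ))
    (hfne : f b j Λ ≠ 0) :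
    ((∃ B : Submodule 𝒪[E] (Fin 2 → E), B.toAddSubgroup.map φ = Λ ∧
          ∃ L₃ : Submodule 𝒪[E] (Fin 3 → E), IsSelfDualLattice σ ϖ (!![H₂ 0 0, 0, H₂ 0 1; 0, hW, 0; H₂ 1 0, 0, H₂ 1 1] : Matrix (Fin 3) (Fin 3) E) L₃ ∧
            L₃ ⊓ LinearMap.ker ((LinearMap.proj (1 : Fin 3) : (Fin 3 → E) →ₗ[E] E).restrictScalars 𝒪[E]) =
              B.map ((Matrix.toLin' (!![1, 0; 0, 0; 0, 1] : Matrix (Fin 3) (Fin 2) E)).restrictScalars 𝒪[E]) ∧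
            (∀ c : E, (Pi.single 1 c : Fin 3 → E) ∈ L₃ ↔ Valued.v c ≤ Valued.v ϖ ^ b) ∧
            ((LatticeInLevel ϖ (d % 2) ((((endoGL (γ₂, u) : GL (Fin 3) E) : Matrix (Fin 3) (Fin 3) E) - 1)) L₃ ∧
                ¬ LatticeInLevel ϖ (d % 2 + 1) ((((endoGL (γ₂, u) : GL (Fin 3) E) : Matrix (Fin 3) (Fin 3) E) - 1)) L₃) ∧
              {z : E | ∃ y ∈ L₃, Valued.v ((ϖ ^ (mstarOfRecord d))⁻¹ * (z - pairing σ (!![H₂ 0 0, 0, H₂ 0 1; 0, hW, 0; H₂ 1 0, 0, H₂ 1 1] : Matrix (Fin 3) (Fin 3) E) y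
                  (((((endoGL (γ₂, u) : GL (Fin 3) E) : Matrix (Fin 3) (Fin 3) E) - 1)) *ᵥ y))) ≤ 1} = valueSetMod σ ϖ (mstarOfRecord d) (xPlus σ ϖ d))) ↔
      ∃ Ve : E, jE Ve = (ρ (h * (x₀ * Θ x₀)) / (h * (x₀ * Θ x₀) + ρ (h * (x₀ * Θ x₀))) - κ₀) / ξ₀ ∧ Valued.v (γ₁ * (Ve - W₁)) = 1 ∧
        (Valued.v (γ₁ * (Ve - W₁)) = 1 → normSign σ (γ₁ * (Ve - W₁)) = normSign σ (-hW))) ∧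
    ((∃ B : Submodule 𝒪[E] (Fin 2 → E), B.toAddSubgroup.map φ = Λ ∧
          ∃ L₃ : Submodule 𝒪[E] (Fin 3 → E), IsSelfDualLattice σ ϖ (!![H₂ 0 0, 0, H₂ 0 1; 0, hW, 0; H₂ 1 0, 0, H₂ 1 1] : Matrix (Fin 3) (Fin 3) E) L₃ ∧
            L₃ ⊓ LinearMap.ker ((LinearMap.proj (1 : Fin 3) : (Fin 3 → E) →ₗ[E] E).restrictScalars 𝒪[E]) =
              B.map ((Matrix.toLin' (!![1, 0; 0, 0; 0, 1] : Matrix (Fin 3) (Fin 2) E)).restrictScalars 𝒪[E]) ∧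
            (∀ c : E, (Pi.single 1 c : Fin 3 → E) ∈ L₃ ↔ Valued.v c ≤ Valued.v ϖ ^ b) ∧
            ((LatticeInLevel ϖ (d % 2) ((((endoGL (γ₂, u) : GL (Fin 3) E) : Matrix (Fin 3) (Fin 3) E) - 1)) L₃ ∧
                ¬ LatticeInLevel ϖ (d % 2 + 1) ((((endoGL (γ₂, u) : GL (Fin 3) E) : Matrix (Fin 3) (Fin 3) E) - 1)) L₃) ∧
              {z : E | ∃ y ∈ L₃, Valued.v ((ϖ ^ (mstarOfRecord d))⁻¹ * (z - pairing σ (!![H₂ 0 0, 0, H₂ 0 1; 0, hW, 0; H₂ 1 0, 0, H₂ 1 1] : Matrix (Fin 3) (Fin 3) E) y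
                  (((((endoGL (γ₂, u) : GL (Fin 3) E) : Matrix (Fin 3) (Fin 3) E) - 1)) *ᵥ y))) ≤ 1} = valueSetMod σ ϖ (mstarOfRecord d) (c₀ • xPlus σ ϖ d))) ↔
      ∃ Ve : E, jE Ve = (ρ (h * (x₀ * Θ x₀)) / (h * (x₀ * Θ x₀) + ρ (h * (x₀ * Θ x₀))) - κ₀) / ξ₀ ∧ Valued.v (γ₁ * (Ve - W₁)) = 1 ∧
        ¬ (Valued.v (γ₁ * (Ve - W₁)) = 1 → normSign σ (γ₁ * (Ve - W₁)) = normSign σ (-hW))) := by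
  obtain ⟨hσσ, hvσ, hϖ, -, hd, hd1, -⟩ := id hD
  have h2v : Valued.v (2 : E) < 1 := v_two_lt_one_of_not_isUnit_two h2
  have hvϖ0 : Valued.v ϖ ≠ 0 := by rw [hϖ]; exact exp_ne_zero
  have hϖ0 : ϖ ≠ 0 := fun h0 => hvϖ0 (by rw [h0, map_zero])
  have hϖlt : Valued.v ϖ < 1 := by rw [hϖ, ← exp_zero, exp_lt_exp]; norm_num
  have hϖ1 : Valued.v ϖ ≤ 1 := hϖlt.le
  have hjϖ0 : jE ϖ ≠ 0 := (map_ne_zero jE).2 hϖ0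
  have hjϖv : Valued.v (jE ϖ) = Valued.v ϖ := hjiso ϖ
  have hvjϖ0 : Valued.v (jE ϖ) ≠ 0 := by rw [hjϖv]; exact hvϖ0
  have hjϖ1 : Valued.v (jE ϖ) ≤ 1 := by rw [hjϖv]; exact hϖ1
  have hjv : ∀ c, Valued.v (jE c) ≤ 1 ↔ Valued.v c ≤ 1 := fun c => by rw [hjiso]
  have hρj : ∀ c : E, ρ (jE c) = jE c := fun c => (hjfix _).2 ⟨c, rfl⟩
  have hsmall : Valued.v ϖ ^ (2 * d - 1) < 1 := pow_lt_one₀ zero_le hϖlt (by omega)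
  have hξpos : (0 : ℤᵐ⁰) < Valued.v ξ₀ := zero_lt_iff.2 ((Valuation.ne_zero_iff _).2 hξ0)
  have hccApos : (0 : ℤᵐ⁰) < Valued.v (jE ϖ ^ j * (α - ρ α)) := zero_lt_iff.2 ((Valuation.ne_zero_iff _).2 hcc)
  have hms : mstarOfRecord d = d % 2 + 2 * d - 1 := rfl
  -- `|cc(α − ρα)| ≤ |jEϖ|^j ≤ |jEϖ|^{d−1}` (`d ≤ b ≤ j`, `|α| ≤ 1`)
  have hjd : Valued.v (jE ϖ ^ j * (α - ρ α)) ≤ Valued.v (jE ϖ) ^ (d - 1) := by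
    have hA1 : Valued.v (α - ρ α) ≤ 1 := (Valuation.map_sub _ _ _).trans (max_le hα1 (by rw [hvρ]; exact hα1))
    rw [Valuation.map_mul, Valuation.map_pow]
    exact (mul_le_of_le_one_right' hA1).trans (pow_le_pow_right_of_le_one' hjϖ1 (by omega))
  set μ : M := lam - jE ((u : Matrix (Fin 1) (Fin 1) E) 0 0) with hμdef
  set tp : E := (ϖ - σ ϖ) * ((ϖ * σ ϖ) ^ ((d - d % 2) / 2))⁻¹ with htpdef
  have htpv : Valued.v tp = Valued.v ϖ ^ (d % 2) := v_refSkew_eq hvσ hϖ hd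
  have htp0 : tp ≠ 0 := fun h00 => by rw [h00, map_zero] at htpv; exact pow_ne_zero _ hvϖ0 htpv.symm
  obtain ⟨hx₀, hΛx, hyO, hyprim, hylev, hdep⟩ := hG
  have hG5 : x₀ ≠ 0 ∧ (∀ x, x ∈ Λ ↔ ∃ ζ, IsOrd ρ α (jE ϖ ^ j) ζ ∧ x = x₀ * ζ) ∧
      IsOrd ρ α (jE ϖ ^ j) (dualGen ρ Θ α (jE ϖ ^ j) h x₀) ∧ ¬ IsOrd ρ α (jE ϖ ^ j) (dualGen ρ Θ α (jE ϖ ^ j) h x₀ / jE ϖ) ∧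
      Valued.v (dualGen ρ Θ α (jE ϖ ^ j) h x₀) = Valued.v (jE ϖ) ^ b := ⟨hx₀, hΛx, hyO, hyprim, hylev⟩
  have hΛmem : Λ ∈ levelSetDep ρ Θ α (jE ϖ) h j b μ := ⟨⟨x₀, hx₀, hΛx, hyO, hyprim, hylev⟩, hdep⟩
  -- the frame of `x₀` itself
  obtain ⟨w₀, V, -, hσV, -, hjV, -, -, -⟩ := exists_vertexFrame_of_gen (α := α) hD jE hjiso hjfix hΘj hρρ hvρ hΘΘ hΘρ hvΘ hΘh hh hH₂σ φ hφo hform hb1 hcc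
    hFgap hκ₀ hΘκ₀ hξ hΘξ hξ0 hκ₀v hR Λ x₀ hG5
  -- strict forms of the slope and root letters
  have hγ0 : γ₁ ≠ 0 := by
    intro h0
    rw [h0, Valuation.map_zero, zero_mul, sub_zero] at hθ
    have hq : BE / (P * tp) = 0 := (Valuation.zero_iff _).1 (le_antisymm hθ zero_le)
    have hBE0 : BE = 0 := by rwa [div_eq_zero_iff, or_iff_left (mul_ne_zero hP0 htp0)] at hq
    have : (μ - ρ μ) * ξ₀ = 0 := by rw [← hBE, hBE0, map_zero]
    exact mul_ne_zero (sub_ne_zero.2 (Ne.symm hμρ)) hξ0 this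
  have hγpos : (0 : ℤᵐ⁰) < Valued.v γ₁ := zero_lt_iff.2 ((Valuation.ne_zero_iff _).2 hγ0)
  have hθlt : Valued.v (BE / (P * tp) - γ₁) < Valued.v γ₁ :=
    hθ.trans_lt (by
      calc Valued.v γ₁ * Valued.v ϖ ^ (2 * d - 1) < Valued.v γ₁ * 1 := mul_lt_mul_of_pos_left hsmall hγpos
        _ = Valued.v γ₁ := mul_one _)
  have hWlt : Valued.v (γ₁ * (W - W₁)) < 1 := hWW.trans_lt hsmall
  -- transfer of sphere and sign between two fixed coordinates `V′, V` with `|γ₁(V′ − V)| ≤ |ϖ|^{2d−1}`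
  have htransfer : ∀ V' : E, σ V' = V' → Valued.v (γ₁ * (V' - V)) ≤ Valued.v ϖ ^ (2 * d - 1) →
      (Valued.v (γ₁ * (V' - W₁)) = 1 ↔ Valued.v (γ₁ * (V - W₁)) = 1) ∧
      (Valued.v (γ₁ * (V - W₁)) = 1 → normSign σ (γ₁ * (V' - W₁)) = normSign σ (γ₁ * (V - W₁))) := by
    intro V' hσV' hVV
    have hVVlt : Valued.v (γ₁ * (V' - V)) < 1 := hVV.trans_lt hsmall
    have hsph : Valued.v (γ₁ * (V' - W₁)) = 1 ↔ Valued.v (γ₁ * (V - W₁)) = 1 := by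
      have e1 : γ₁ * (V' - W₁) = γ₁ * (V - W₁) + γ₁ * (V' - V) := by ring
      have e2 : γ₁ * (V - W₁) = γ₁ * (V' - W₁) - γ₁ * (V' - V) := by ring
      constructor
      · intro h1; rw [e2, Valuation.map_sub_eq_of_lt_left _ (by rw [h1]; exact hVVlt), h1]
      · intro h1; rw [e1, Valuation.map_add_eq_of_lt_left _ (by rw [h1]; exact hVVlt), h1]
    refine ⟨hsph, fun h1 => ?_⟩
    have hσg : σ (γ₁ * (V - W₁)) = γ₁ * (V - W₁) := by rw [map_mul, map_sub, hσγ, hσV, hσW₁]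
    have hσg' : σ (γ₁ * (V' - W₁)) = γ₁ * (V' - W₁) := by rw [map_mul, map_sub, hσγ, hσV', hσW₁]
    refine normSign_eq_of_near hD hσg hσg' h1 (n := 2 * d - 1) le_rfl ?_
    have e : γ₁ * (V - W₁) - γ₁ * (V' - W₁) = -(γ₁ * (V' - V)) := by ring
    rw [e, Valuation.map_neg]; exact hVV
  -- ★ p864672: the two literals of a populated member read `NX ∧ Pc` ∕ `NX ∧ ¬Pc`
  have R := reads_of_weight_ne_zero σ hσσ hvσ hϖ hD h2 hH₂ hH₂σ hhW hhWσ jE hρρ hvρ hα hα1 hint hΘΘ hΘρ hvΘ hΘj hjv hjiso hjfix hjpow hϖmax φ hφs hφi hφo hφγ hvlam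
    hΘh hh hform hlam2 hρlam u P₁ hA hΓ hnF hu1N hlam1 hb1 hdb hlamj hμl hlamρ hμk hprod f hf NX hNX Pc hPc hσc₀ hc₀1 hc₀N Λ hΛmem hfne
  -- a presentation `x₁` of `Λ` WITH a `σ`-fixed unit glue `r₁` (★ `exists_fixed_unit_weight_eq_natCard_normFibre`)
  obtain ⟨x₁, r₁, hx₁, hΛx₁, hyO₁, hyp₁, hylev₁, -, hσr₁, hr₁1, hr₁g, -⟩ :=
    exists_fixed_unit_weight_eq_natCard_normFibre σ hσσ hvσ hϖ hH₂σ hhW hhWσ jE hρρ hvρ hα hα1 hint hΘΘ hΘρ hvΘ hΘj hjv hjfix hjpow hϖmax φ hφs hφi hφo hφγ hvlam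
      hΘh hh hform ((u : Matrix (Fin 1) (Fin 1) E) 0 0) hb1 hlamj f hf hΛmem
  have hG5₁ : x₁ ≠ 0 ∧ (∀ x, x ∈ Λ ↔ ∃ ζ, IsOrd ρ α (jE ϖ ^ j) ζ ∧ x = x₁ * ζ) ∧
      IsOrd ρ α (jE ϖ ^ j) (dualGen ρ Θ α (jE ϖ ^ j) h x₁) ∧ ¬ IsOrd ρ α (jE ϖ ^ j) (dualGen ρ Θ α (jE ϖ ^ j) h x₁ / jE ϖ) ∧
      Valued.v (dualGen ρ Θ α (jE ϖ ^ j) h x₁) = Valued.v (jE ϖ) ^ b := ⟨hx₁, hΛx₁, hyO₁, hyp₁, hylev₁⟩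
  -- the frame at `x₁`
  obtain ⟨w₁, V₁, hw₁Y, hσV₁, -, hjV₁, -, hσpw₁, hpwP₁⟩ := exists_vertexFrame_of_gen (α := α) hD jE hjiso hjfix hΘj hρρ hvρ hΘΘ hΘρ hvΘ hΘh hh hH₂σ φ hφo hform
    hb1 hcc hFgap hκ₀ hΘκ₀ hξ hΘξ hξ0 hκ₀v hR Λ x₁ hG5₁
  set pw₁ : E := pairing σ H₂ w₁ w₁ with hpw₁def
  have hpwP₁' : Valued.v (pw₁ * P) = 1 := by rw [hPb]; exact hpwP₁
  have hpw₁0 : pw₁ ≠ 0 := fun h0 => by rw [h0, zero_mul, Valuation.map_zero] at hpwP₁'; exact zero_ne_one hpwP₁'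
  obtain ⟨-, -, ht₁⟩ := trace_letters (α := α) hρρ hΘΘ hΘρ hΘh (hρj ϖ) hjϖ0 hjϖ1 hb1 hcc hFgap hyO₁ hyp₁ hylev₁
  set u₁ : M := h * (x₁ * Θ x₁) with hu₁def
  have ht₁0 : u₁ + ρ u₁ ≠ 0 := fun h0 => by rw [h0, map_zero] at ht₁; exact zero_ne_one ht₁
  -- the digit value at `x₁`: `a₁ = BE·(V₁ − W)`, `jE a₁ = ρμ + (μ − ρμ)·κ̂(u₁)`
  have hμρ0 : ρ μ - μ ≠ 0 := sub_ne_zero.2 hμρ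
  have hκhat : ρ u₁ / (u₁ + ρ u₁) = κ₀ + jE V₁ * ξ₀ := by
    rw [hjV₁, div_mul_cancel₀ _ hξ0]; ring
  have ha₁ : jE (BE * (V₁ - W)) = ρ μ + (μ - ρ μ) * (ρ u₁ / (u₁ + ρ u₁)) := by
    have hκ₀W : κ₀ = ρ μ / (ρ μ - μ) - jE W * ξ₀ := by rw [hWc]; ring
    rw [map_mul, map_sub, hBE, hκhat, hκ₀W]
    field_simp
    ring
  -- ★ p864917 at the frame `(x₁, r₁, w₁, a₁)`
  obtain ⟨hNXr, hPcr⟩ := digitReads_of_presentation σ hσσ hvσ hϖ hD h2 h2v hH₂ hH₂σ hhW hhWσ jE hρρ hvρ hα hα1 hint hΘΘ hΘρ hvΘ hΘj hjv hjiso hjfix hjpow hϖmax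
    φ hφs hφi hφo hφγ hvlam hΘh hh hform hlam2 hρlam u P₁ hA hΓ hnF hu1N hlam1 hb1 hdb hlamj hμl hlamρ hμk hprod f hf NX hNX Pc hPc z hz1 ξf hzξ hσξf hξN Λ hΛmem
    x₁ r₁ w₁ (BE * (V₁ - W)) hx₁ hΛx₁ hyO₁ hyp₁ hylev₁ hσr₁ hr₁1 hr₁g hw₁Y hσpw₁ hpw₁0 ht₁0 ha₁
  -- `NX` is the sphere digit at `V₁`: `|⟨w₁,w₁⟩|·|a₁| = |⟨w₁,w₁⟩P|·|t₊|·|θ(V₁ − W)| = |ϖ|^{ℓ₀}·|γ₁(V₁ − W)|`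
  have hBEθ : BE = BE / (P * tp) * (P * tp) := by rw [div_mul_cancel₀ _ (mul_ne_zero hP0 htp0)]
  have hval : Valued.v pw₁ * Valued.v (BE * (V₁ - W)) = Valued.v ϖ ^ (d % 2) * Valued.v (γ₁ * (V₁ - W)) := by
    have e : pw₁ * (BE * (V₁ - W)) = (pw₁ * P) * tp * (BE / (P * tp) * (V₁ - W)) := by
      rw [div_mul_eq_mul_div, mul_comm P tp]; field_simp
    rw [← Valuation.map_mul, e, Valuation.map_mul, Valuation.map_mul, hpwP₁', one_mul, htpv, v_mul_eq_of_v_sub_lt hθlt]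
  have hNX₁ : NX Λ ↔ Valued.v (γ₁ * (V₁ - W₁)) = 1 := by
    rw [hNXr, hval, ← v_centre_iff_of_lt hWlt V₁]
    constructor
    · intro h1
      have h2 : Valued.v ϖ ^ (d % 2) * Valued.v (γ₁ * (V₁ - W)) = Valued.v ϖ ^ (d % 2) * 1 := by rw [h1, mul_one]
      exact mul_left_cancel₀ (pow_ne_zero _ hvϖ0) h2
    · intro h1; rw [h1, mul_one]
  -- ON the sphere, `Pc` is the sign: `e′ = ⟨w₁,w₁⟩·P·γ₁(V₁ − W₁)` is a fixed unit `m⋆`-close to `⟨w₁,w₁⟩a₁∕t₊`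
  have hPc₁ : Valued.v (γ₁ * (V₁ - W₁)) = 1 → (Pc Λ ↔ normSign σ (γ₁ * (V₁ - W₁)) = normSign σ (-hW)) := by
    intro hsph₁
    have hsphW : Valued.v (γ₁ * (V₁ - W)) = 1 := (v_centre_iff_of_lt hWlt V₁).2 hsph₁
    set e' : E := pw₁ * P * (γ₁ * (V₁ - W₁)) with he'def
    have he'σ : σ e' = e' := by rw [he'def, map_mul, map_mul, hσpw₁, hσP, map_mul, map_sub, hσγ, hσV₁, hσW₁]
    have he'1 : Valued.v e' = 1 := by rw [he'def, Valuation.map_mul, hpwP₁', one_mul, hsph₁]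
    have hclose : Valued.v (pw₁ * (BE * (V₁ - W)) - e' * tp) ≤ Valued.v ϖ ^ mstarOfRecord d := by
      have e2 : pw₁ * (BE * (V₁ - W)) - e' * tp = (pw₁ * P) * tp * ((BE / (P * tp) - γ₁) * (V₁ - W) + γ₁ * (W₁ - W)) := by
        rw [he'def]; field_simp; ring
      have hexp : Valued.v ϖ ^ mstarOfRecord d = Valued.v ϖ ^ (d % 2) * Valued.v ϖ ^ (2 * d - 1) := by
        rw [← pow_add]; congr 1; rw [hms]; omega
      rw [e2, Valuation.map_mul, Valuation.map_mul, hpwP₁', one_mul, htpv, hexp]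
      refine mul_le_mul' le_rfl ((Valuation.map_add _ _ _).trans (max_le ?_ ?_))
      · rw [Valuation.map_mul]
        calc Valued.v (BE / (P * tp) - γ₁) * Valued.v (V₁ - W) ≤ Valued.v γ₁ * Valued.v ϖ ^ (2 * d - 1) * Valued.v (V₁ - W) := mul_le_mul' hθ le_rfl
          _ = Valued.v (γ₁ * (V₁ - W)) * Valued.v ϖ ^ (2 * d - 1) := by rw [Valuation.map_mul]; ac_rfl
          _ = Valued.v ϖ ^ (2 * d - 1) := by rw [hsphW, one_mul]
      · have e3 : γ₁ * (W₁ - W) = -(γ₁ * (W - W₁)) := by ring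
        rw [e3, Valuation.map_neg]; exact hWW
    rw [hPcr e' he'σ he'1 hclose]
    -- `−(e′∕⟨w₁,w₁⟩)∕h_W = γ₁(V₁ − W₁)·(−(P∕h_W))` and `ω(−(P∕h_W)) = ω(−h_W)` (`P∕h_W² = N(ϖ^b∕h_W)`)
    have hhW0 : hW ≠ 0 := fun h0 => by rw [h0, map_zero] at hhW; exact zero_ne_one hhW
    have hq : -(e' / pw₁) / hW = (γ₁ * (V₁ - W₁)) * (-(P / hW)) := by rw [he'def]; field_simp
    rw [hq]
    have hXσ : σ (γ₁ * (V₁ - W₁)) = γ₁ * (V₁ - W₁) := by rw [map_mul, map_sub, hσγ, hσV₁, hσW₁]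
    have hX0 : γ₁ * (V₁ - W₁) ≠ 0 := fun h0 => by rw [h0, Valuation.map_zero] at hsph₁; exact zero_ne_one hsph₁
    have hYσ : σ (-(P / hW)) = -(P / hW) := by rw [map_neg, map_div₀, hσP, hhWσ]
    have hY0 : -(P / hW) ≠ 0 := neg_ne_zero.2 (div_ne_zero hP0 hhW0)
    have hY : normSign σ (-(P / hW)) = normSign σ (-hW) := by
      have e3 : -(P / hW) = (-hW) * (ϖ ^ b / hW * σ (ϖ ^ b / hW)) := by
        rw [map_div₀, map_pow, hhWσ, hPb, mul_pow]; field_simp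
      have hn0 : ϖ ^ b / hW * σ (ϖ ^ b / hW) ≠ 0 := by
        refine mul_ne_zero (div_ne_zero (pow_ne_zero _ hϖ0) hhW0) ?_
        rw [map_div₀, map_pow, hhWσ]; exact div_ne_zero (pow_ne_zero _ ((map_ne_zero σ).2 hϖ0)) hhW0
      have hnσ : σ (ϖ ^ b / hW * σ (ϖ ^ b / hW)) = ϖ ^ b / hW * σ (ϖ ^ b / hW) := by rw [map_mul, hσσ, mul_comm]
      rw [e3, normSign_mul_of_fixed hD (by rw [map_neg, hhWσ]) hnσ (neg_ne_zero.2 hhW0) hn0, normSign_of_isNorm σ ⟨ϖ ^ b / hW, rfl⟩, mul_one]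
    have hiff : (∃ c : E, c * σ c = γ₁ * (V₁ - W₁) * -(P / hW)) ↔ normSign σ (γ₁ * (V₁ - W₁) * -(P / hW)) = 1 := by
      refine ⟨fun h1 => normSign_of_isNorm σ h1, fun h1 => ?_⟩
      by_contra hn
      rw [normSign, if_neg hn] at h1
      exact absurd h1 (by norm_num)
    rw [hiff, normSign_mul_of_fixed hD hXσ hYσ hX0 hY0, mul_comm, hY]
    exact normSign_mul_eq_one_iff_eq rfl _
  -- SHARP generator independence (★ p864599): `|γ₁(V₁ − V)| ≤ |ϖ|^{2d−1}`
  have hnear : Valued.v (γ₁ * (V₁ - V)) ≤ Valued.v ϖ ^ (2 * d - 1) := by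
    have hmul := v_coord_sub_coord_mul_le_sharp_of_gen jE hjfix hjϖ0 hjϖ1 hρρ hvρ hΘΘ hΘρ hDM hΘh hb1 hcc hFgap κ₀ hξ0 Λ x₀ x₁ hG5 hG5₁
    rw [← hjV₁, ← hjV, ← map_sub, hjiso, max_eq_left hjd, ← pow_add, hjϖv, show 2 * b + (d - 1) = 2 * b + d - 1 by omega] at hmul
    refine le_of_mul_le_mul_right ?_ (mul_pos hξpos hccApos)
    rw [Valuation.map_mul]
    calc Valued.v γ₁ * Valued.v (V₁ - V) * (Valued.v ξ₀ * Valued.v (jE ϖ ^ j * (α - ρ α)))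
        = Valued.v γ₁ * (Valued.v (V₁ - V) * Valued.v ξ₀ * Valued.v (jE ϖ ^ j * (α - ρ α))) := by ac_rfl
      _ ≤ Valued.v γ₁ * Valued.v ϖ ^ (2 * b + d - 1) := mul_le_mul' le_rfl hmul
      _ ≤ Valued.v ϖ ^ (2 * d - 1) * (Valued.v ξ₀ * Valued.v (jE ϖ ^ j * (α - ρ α))) := hγr
  obtain ⟨hsphT, hsignT⟩ := htransfer V₁ hσV₁ hnear
  -- `jE` is injective: the coordinate is pinned
  have hVf : ∀ Ve : E, jE Ve = (ρ (h * (x₀ * Θ x₀)) / (h * (x₀ * Θ x₀) + ρ (h * (x₀ * Θ x₀))) - κ₀) / ξ₀ → Ve = V :=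
    fun Ve h1 => jE.injective (h1.trans hjV.symm)
  refine ⟨⟨?_, ?_⟩, ⟨?_, ?_⟩⟩
  · intro hP
    obtain ⟨hN, hPcΛ⟩ := R.1.1 hP
    have hs₁ : Valued.v (γ₁ * (V₁ - W₁)) = 1 := hNX₁.1 hN
    have hs : Valued.v (γ₁ * (V - W₁)) = 1 := hsphT.1 hs₁
    exact ⟨V, hjV, hs, fun _ => by rw [← hsignT hs]; exact (hPc₁ hs₁).1 hPcΛ⟩
  · rintro ⟨Ve, hjVe, hNXV, hψ⟩
    have hVe := hVf Ve hjVe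
    subst Ve
    have hs₁ : Valued.v (γ₁ * (V₁ - W₁)) = 1 := hsphT.2 hNXV
    exact R.1.2 ⟨hNX₁.2 hs₁, (hPc₁ hs₁).2 (by rw [hsignT hNXV]; exact hψ hNXV)⟩
  · intro hQ
    obtain ⟨hN, hnPc⟩ := R.2.1 hQ
    have hs₁ : Valued.v (γ₁ * (V₁ - W₁)) = 1 := hNX₁.1 hN
    have hs : Valued.v (γ₁ * (V - W₁)) = 1 := hsphT.1 hs₁
    exact ⟨V, hjV, hs, fun hψ => hnPc ((hPc₁ hs₁).2 (by rw [hsignT hs]; exact hψ hs))⟩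
  · rintro ⟨Ve, hjVe, hNXV, hψ⟩
    have hVe := hVf Ve hjVe
    subst Ve
    have hs₁ : Valued.v (γ₁ * (V₁ - W₁)) = 1 := hsphT.2 hNXV
    exact R.2.2 ⟨hNX₁.2 hs₁, fun hPcΛ => hψ fun _ => by rw [← hsignT hNXV]; exact (hPc₁ hs₁).1 hPcΛ⟩

end Summit.HodgeConjecture.HodgeConjecture.Cruxes.H413.F0P3cDyRamUpperMixCellLiteralReads

end
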